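import Mathlib
import Summits.KontsevichZagierPeriods.Zeta5Search.Profile10aCellsA
import Summits.KontsevichZagierPeriods.Zeta5Search.Profile10aCellsB
import Summits.KontsevichZagierPeriods.Zeta5Search.Profile10bCellsA
import Summits.KontsevichZagierPeriods.Zeta5Search.Profile10bCellsB
import Summits.KontsevichZagierPeriods.Zeta5Search.DenomLaw.Profile11PathA
import Summits.KontsevichZagierPeriods.Zeta5Search.DenomLaw.Profile15aPath
import Summits.KontsevichZagierPeriods.Zeta5Search.DenomLaw.ZeroPointCoverKit
import Summits.KontsevichZagierPeriods.Zeta5Search.DenomLaw.ZeroCoverKit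
import Summits.KontsevichZagierPeriods.Zeta5Search.DenomLaw.LawA3KCoverKit
import Summits.KontsevichZagierPeriods.Zeta5Search.DenomLaw.LawA4CoverKit
import Summits.KontsevichZagierPeriods.Zeta5Search.DenomLaw.LawZACoverKit
import Summits.KontsevichZagierPeriods.Zeta5Search.DenomLaw.LawZL5CoverKit
import Summits.KontsevichZagierPeriods.Zeta5Search.DenomLaw.PathWeightProfile
import Summits.KontsevichZagierPeriods.Zeta5Search.CasoratianClassBoundPal
import Summits.KontsevichZagierPeriods.Zeta5Search.FlagRayDominance
import Summits.KontsevichZagierPeriods.Zeta5Search.TopFamilyFPCasLB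
import HarnessLib

/-!
# ζ(5) search — the `N_p = 10` PROFILES 10a AND 10b of the first period for EVERY sorted parameter vector: PATH accounting at every depth (DENOM-LAW D1, prover-d1 gen 22)

Cell `pub-zeta5` (HONEST FRAMING: systematic search; no irrationality claim unless certified), TRACK «DENOM-LAW» D1 prover seat (denom-prover-d1
gen 22, `HOME/denom-law/prover-d1/ATTEMPT-22.md` §6).  The five a = 7 profiles with exactly eleven short pair blocks: 10a short = all `(1,k)`, `(2,k)` (`C⋆ ≤ 9`,
new finite check; THEOREM A⁗ `cover_A4` at `(6,[1,−4,−4,1])` = `−5` at `⌊d/p⌋ ≤ 1` — no hypothesis on `d` —, THEOREM ZA `cover_ZA` `(6; [[1,−4,−4,1]], [])` = `−4` at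
`⌊d/p⌋ = 2`; node `−6 / −5 / −4`); 10b short = all `(i,k)` with `k ≤ 5`, and `(1,6)` (`C⋆ ≤ 9`, new finite check; `d < 2p`; THEOREM LB `(−4,−1)` for every `d` via
`casLB_ge_of_cover_le0` (gen 22's `Profile11PathA`); node `−6 / −5`); 10c short `(1,k)`, `(2,3),(2,4),(2,5),(3,4),(3,5)` and 10e short `(1,k)`, `(2,3),…,(2,6),(3,4)`
(`C⋆ ≤ 10` by gen 18's `cStar_le_ten_15a`; `p ≤ d < 2p`; the LEMMA-D bonus `cover_J_j` at `m = −4` = `−4` = node); 10d short `(i,k)` with `i ≤ 2, k ≤ 6`, and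
`(3,4),(3,5)` (`C⋆ ≤ 10` by gen 22's `cStar_le_ten_12b`; `p ≤ d < 2p`; THEOREM LB♯ — gen 19's `casoratian_bound_pal` through gen 21's `rowsPal_of_cover`, wrapped
here as `cover_LBP_j` — with `VB = −4` and palindromic row `4 + E = 0` on `[1,−3,−3,1]`: `−4` = node).  Covers `FullProfile.cover10x_ev/od` (`Profile10{a,…,e}Cells{A,B}`,
machine-generated; every check `decide`).  Results: `pathAccounting_profile10x` (every `j`) and **`pathAccountingFirstPeriod_profile10x`** (the node's binders
VERBATIM plus `p ≤ b₇` and the profile inequalities; no depth hypothesis), x ∈ {a, b}.  Census beside the proof (gen 22, exhaustive a = 7 at p = 7, 11, 8 %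
sample at p = 13): 10a 4,838 · 10b 1,645 · 10c 1,286 · 10d 865 · 10e 678 instances, every one reached by exactly these rungs; 0 open at p ≤ 13 (kit j285126).
MODEL/structure-side valuation bookkeeping of the cell's own rationals; nothing about ζ(5); no γ; records in print UNMOVED.
-/

open Finset

namespace Summit.KontsevichZagierPeriods.Zeta5Search.FullProfile

open Summit.KontsevichZagierPeriods.Zeta5Search.ClusterValuation
open Summit.KontsevichZagierPeriods.Zeta5Search.CasoratianValuation (InPolytope shift casoratian pairFloors refund)
open Summit.KontsevichZagierPeriods.Zeta5Search.WedgeDictionary (dOf)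
open Summit.KontsevichZagierPeriods.Zeta5Search.ClassTypeCover
open Summit.KontsevichZagierPeriods.Zeta5Search.DenomLaw (cStar FirstPeriod Sorted7 zeroClasses_of_cover zeroBound_of_classes zeroPointBound_of_classes cover_A3K cover_A4 cover_ZA rowsPal_of_cover)
open Summit.KontsevichZagierPeriods.Zeta5Search.DenomLaw.FirstPeriodKit (cStar_le_eleven sorted7_chain firstPeriod_pair pairFloors_expand)
open Summit.KontsevichZagierPeriods.Zeta5Search.ZeroWindows (ZeroWindowClasses)
open Summit.KontsevichZagierPeriods.Zeta5Search.TopFamFP (cover_J_j)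
open Summit.KontsevichZagierPeriods.Zeta5Search.StairFLAG (cover_B_j)
open Summit.KontsevichZagierPeriods.Zeta5Search.SortedProfile

/-! ## Kit: THEOREM LB from a cover with a non-positive row constant; `C⋆ ≤ 9` on 10a, 10b -/

/-- **`C⋆ ≤ 9` on the `N_p = 10` profile 10a** (all blocks through parameters 1, 2 short: both are path ends or carry a short edge): the finite check over
the 5,040 orderings (`decide +kernel`). -/
theorem cStar_le_nine_10a {b : ℕ → ℤ} {p : ℕ} (hs : Sorted7 b) (hQ : b 0 < (p : ℤ) + b 2 + b 7) : cStar b p ≤ 9 := by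
  obtain ⟨h21, h32, h43, h54, h65, h76⟩ := sorted7_chain hs
  refine DenomLaw.FirstPeriodKit.cStar_le_of_profile (fun _ => True) (fun i k => ¬ ((i.val ≤ 1 ∨ k.val ≤ 1) ∧ i.val ≠ k.val)) 9
    (fun _ _ => trivial) ?_ (by decide +kernel)
  intro i k hik h
  obtain ⟨h, hne⟩ := h
  have key : b 2 + b 7 ≤ b (i.val + 1) + b (k.val + 1) := by
    have := i.isLt; have := k.isLt
    rcases h with hi | hk
    · interval_cases hv : i.val <;> interval_cases hw : k.val <;> simp only [Nat.reduceAdd] <;> omega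
    · interval_cases hv : i.val <;> interval_cases hw : k.val <;> simp only [Nat.reduceAdd] <;> omega
  linarith


/-- **`C⋆ ≤ 9` on the `N_p = 10` profile 10b** (every long block touches parameter 6 or 7): the finite check over the 5,040 orderings. -/
theorem cStar_le_nine_10b {b : ℕ → ℤ} {p : ℕ} (hs : Sorted7 b) (hQ : b 0 < (p : ℤ) + b 4 + b 5) (hQ16 : b 0 < (p : ℤ) + b 1 + b 6) :
    cStar b p ≤ 9 := by
  obtain ⟨h21, h32, h43, h54, h65, h76⟩ := sorted7_chain hs
  refine DenomLaw.FirstPeriodKit.cStar_le_of_profile (fun _ => True)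
    (fun i k => ¬ (((i.val ≤ 4 ∧ k.val ≤ 4) ∨ (i.val = 0 ∧ k.val = 5) ∨ (i.val = 5 ∧ k.val = 0)) ∧ i.val ≠ k.val)) 9
    (fun _ _ => trivial) ?_ (by decide +kernel)
  intro i k hik h
  obtain ⟨h, hne⟩ := h
  have := i.isLt; have := k.isLt
  exfalso
  rcases h with ⟨hi, hk⟩ | ⟨hi, hk⟩ | ⟨hi, hk⟩ <;> interval_cases hv : i.val <;> interval_cases hw : k.val <;>
    simp only [Nat.reduceAdd] at hik <;> omega


/-! ## The `N_p = 10` profile with short blocks `all (1,k) and (2,k)` -/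

section P10A

variable {b : ℕ → ℤ} {j p : ℕ}

/-- On this profile `d(b) < 3p`. -/
theorem d_bounds10a (hs : Sorted7 b) (hP : (p : ℤ) ≤ b 7) (_hQ : b 0 < (p : ℤ) + b 2 + b 7) (_hQ34 : (p : ℤ) + b 3 + b 4 ≤ b 0) (hF1 : b 1 < 2 * (p : ℤ)) :
    True ∧ dOf b < 3 * (p : ℤ) := by
  obtain ⟨h21, h32, h43, h54, h65, h76⟩ := sorted7_chain hs
  rw [DecompositionWholeCone.dOf_expand]; exact ⟨trivial, by linarith⟩

/-- **`N_p = 10`** on this profile: the pair digits of the eleven short blocks are `0`, the other ten are `1`. -/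
theorem pairFloors_eq_10a (hb : InPolytope b) (hs : Sorted7 b) (hp : 0 < p) (hQ : b 0 < (p : ℤ) + b 2 + b 7) (hQ34 : (p : ℤ) + b 3 + b 4 ≤ b 0) (hfp : FirstPeriod b p) : pairFloors b p = 10 := by
  obtain ⟨h21, h32, h43, h54, h65, h76⟩ := sorted7_chain hs
  obtain ⟨h0, hb1, hb2, hb3, hb4, hb5, hb6, hb7, hc1⟩ := box hb
  have hp0 : (0 : ℤ) < p := by exact_mod_cast hp
  have one : ∀ z : ℤ, (p : ℤ) ≤ z → z ≤ 2 * (p : ℤ) - 1 → z / (p : ℤ) = 1 := fun z h1 h2 => by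
    rw [Int.ediv_eq_iff_of_pos hp0]; constructor <;> linarith
  have z12 : (b 0 - b 1 - b 2) / (p : ℤ) = 0 := Int.ediv_eq_zero_of_lt (by linarith) (by linarith)
  have z13 : (b 0 - b 1 - b 3) / (p : ℤ) = 0 := Int.ediv_eq_zero_of_lt (by linarith) (by linarith)
  have z14 : (b 0 - b 1 - b 4) / (p : ℤ) = 0 := Int.ediv_eq_zero_of_lt (by linarith) (by linarith)
  have z15 : (b 0 - b 1 - b 5) / (p : ℤ) = 0 := Int.ediv_eq_zero_of_lt (by linarith) (by linarith)
  have z16 : (b 0 - b 1 - b 6) / (p : ℤ) = 0 := Int.ediv_eq_zero_of_lt (by linarith) (by linarith)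
  have z17 : (b 0 - b 1 - b 7) / (p : ℤ) = 0 := Int.ediv_eq_zero_of_lt (by linarith) (by linarith)
  have z23 : (b 0 - b 2 - b 3) / (p : ℤ) = 0 := Int.ediv_eq_zero_of_lt (by linarith) (by linarith)
  have z24 : (b 0 - b 2 - b 4) / (p : ℤ) = 0 := Int.ediv_eq_zero_of_lt (by linarith) (by linarith)
  have z25 : (b 0 - b 2 - b 5) / (p : ℤ) = 0 := Int.ediv_eq_zero_of_lt (by linarith) (by linarith)
  have z26 : (b 0 - b 2 - b 6) / (p : ℤ) = 0 := Int.ediv_eq_zero_of_lt (by linarith) (by linarith)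
  have z27 : (b 0 - b 2 - b 7) / (p : ℤ) = 0 := Int.ediv_eq_zero_of_lt (by linarith) (by linarith)
  have U := fun (i k : ℕ) (hi : i < 7) (hk : k < 7) (hik : i < k) => firstPeriod_pair hfp hi hk hik
  rw [pairFloors_expand, z12, z13, z14, z15, z16, z17, z23, z24, z25, z26, z27,
    one _ (by linarith) (U 2 3 (by norm_num) (by norm_num) (by norm_num)),
    one _ (by linarith) (U 2 4 (by norm_num) (by norm_num) (by norm_num)),
    one _ (by linarith) (U 2 5 (by norm_num) (by norm_num) (by norm_num)),
    one _ (by linarith) (U 2 6 (by norm_num) (by norm_num) (by norm_num)),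
    one _ (by linarith) (U 3 4 (by norm_num) (by norm_num) (by norm_num)),
    one _ (by linarith) (U 3 5 (by norm_num) (by norm_num) (by norm_num)),
    one _ (by linarith) (U 3 6 (by norm_num) (by norm_num) (by norm_num)),
    one _ (by linarith) (U 4 5 (by norm_num) (by norm_num) (by norm_num)),
    one _ (by linarith) (U 4 6 (by norm_num) (by norm_num) (by norm_num)),
    one _ (by linarith) (U 5 6 (by norm_num) (by norm_num) (by norm_num))]
  norm_num

/-- **THEOREM A⁗ on this profile, general `b`**: `v_p(Cas_j(b)) ≥ −5 = 7 − 2M` in the frame `(6, [1,−4,−4,1])` (gen 18's `DenomLaw.cover_A4`; the five clauses hold on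
both covers, the deep palindrome virtual where only its raises or its centred copy occur). -/
theorem cas_ge10a_neg5 (hb : InPolytope b) (hs : Sorted7 b) (hbj : InPolytope (shift b j)) (hj1 : 1 ≤ j) (hj7 : j ≤ 7)
    (hprime : p.Prime) (hp5 : 5 ≤ p) (hwin : (b 0 + 2 : ℤ) < (p : ℤ) ^ 2) (hP : (p : ℤ) ≤ b 7) (hQ : b 0 < (p : ℤ) + b 2 + b 7) (hQ34 : (p : ℤ) + b 3 + b 4 ≤ b 0)
    (hF1 : b 1 < 2 * (p : ℤ)) (hF2 : b 0 < 2 * (p : ℤ) + b 6 + b 7) (hcas : casoratian b j ≠ 0) : (-5 : ℤ) ≤ padicValRat p (casoratian b j) := by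
  haveI : Fact p.Prime := ⟨hprime⟩
  have hp2 : p % 2 = 1 := Nat.odd_iff.1 (hprime.odd_of_ne_two (by omega))
  obtain ⟨h21, h32, h43, h54, h65, h76⟩ := sorted7_chain hs
  obtain ⟨h0, hb1, hb2, hb3, hb4, hb5, hb6, hb7, hc1⟩ := box hb
  have hpb : (p : ℤ) ≤ b 0 := by linarith
  have hT : ([1, -4, -4, 1] : List ℤ).reverse = [1, -4, -4, 1] := by decide
  rcases Int.emod_two_eq_zero_or_one (b 0) with hr | hr
  · exact cover_A4 hb hbj hj1 hj7 hprime hp5 hpb hwin (cover10a_ev hb hs hP hQ hQ34 hF1 hF2 hp5 hp2 hr) (M := 6) (by norm_num) (by decide) hT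
      (by rw [oddFlag_false hr]; decide) (by norm_num) hcas
  · exact cover_A4 hb hbj hj1 hj7 hprime hp5 hpb hwin (cover10a_od hb hs hP hQ hQ34 hF1 hF2 hp5 hp2 hr) (M := 6) (by norm_num) (by decide) hT
      (by rw [oddFlag_true hr]; decide) (by norm_num) hcas

/-- **THEOREM ZA on this profile at `2p ≤ d`, general `b`**: `v_p(Cas_j(b)) ≥ −4 = 8 − 2M` at `M = 6` (zero-point structure `(6; [[1, -4, -4, 1]], [])` and the five A⁗′ clauses;
gen 20's `DenomLaw.cover_ZA`). -/
theorem cas_ge10a_neg4 (hb : InPolytope b) (hs : Sorted7 b) (hbj : InPolytope (shift b j)) (hj1 : 1 ≤ j) (hj7 : j ≤ 7)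
    (hprime : p.Prime) (hp5 : 5 ≤ p) (hwin : (b 0 + 2 : ℤ) < (p : ℤ) ^ 2) (hP : (p : ℤ) ≤ b 7) (hQ : b 0 < (p : ℤ) + b 2 + b 7) (hQ34 : (p : ℤ) + b 3 + b 4 ≤ b 0)
    (hF1 : b 1 < 2 * (p : ℤ)) (hF2 : b 0 < 2 * (p : ℤ) + b 6 + b 7) (hd : 2 * (p : ℤ) ≤ dOf b) (hcas : casoratian b j ≠ 0) : (-4 : ℤ) ≤ padicValRat p (casoratian b j) := by
  haveI : Fact p.Prime := ⟨hprime⟩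
  have hp2 : p % 2 = 1 := Nat.odd_iff.1 (hprime.odd_of_ne_two (by omega))
  obtain ⟨h21, h32, h43, h54, h65, h76⟩ := sorted7_chain hs
  obtain ⟨h0, hb1, hb2, hb3, hb4, hb5, hb6, hb7, hc1⟩ := box hb
  have hpb : (p : ℤ) ≤ b 0 := by linarith
  have hdeg : (p : ℤ) * (((6 : ℕ) : ℤ) - 2) ≤ 2 * dOf b + 1 := by push_cast; linarith
  have hD : ∀ T ∈ ([[1, -4, -4, 1]] : List (List ℤ)), T.reverse = T := by decide
  rcases Int.emod_two_eq_zero_or_one (b 0) with hr | hr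
  · exact cover_ZA hb hbj hj1 hj7 hprime hp5 hpb hwin (cover10a_ev hb hs hP hQ hQ34 hF1 hF2 hp5 hp2 hr) (M := 6) (by norm_num) (by decide) hD (S := []) (by decide)
      (by rw [oddFlag_false hr]; decide) hdeg (T := [1, -4, -4, 1]) (by decide) (by rw [oddFlag_false hr]; decide) (by norm_num) hcas
  · exact cover_ZA hb hbj hj1 hj7 hprime hp5 hpb hwin (cover10a_od hb hs hP hQ hQ34 hF1 hF2 hp5 hp2 hr) (M := 6) (by norm_num) (by decide) hD (S := []) (by decide)
      (by rw [oddFlag_true hr]; decide) hdeg (T := [1, -4, -4, 1]) (by decide) (by rw [oddFlag_true hr]; decide) (by norm_num) hcas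

/-- **`PathAccountingFirstPeriod`'s conclusion on this `N_p = 10` profile (short blocks `all (1,k) and (2,k)`), EVERY sorted `b`, every direction `j`, every depth**
(`C⋆ ≤ 9`; node `⌊d/p⌋ − 10 + 7`: `-5` at `⌊d/p⌋ = 1`, `-4` at `⌊d/p⌋ = 2`; `p < d < 3p`). -/
theorem pathAccounting_profile10a (b : ℕ → ℤ) (j p : ℕ) (hb : InPolytope b) (hs : Sorted7 b) (hbj : InPolytope (shift b j))
    (hj1 : 1 ≤ j) (hj7 : j ≤ 7) (hprime : p.Prime) (hp5 : 5 ≤ p) (hwin : (b 0 + 2 : ℤ) < (p : ℤ) ^ 2) (hfp : FirstPeriod b p)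
    (hP : (p : ℤ) ≤ b 7) (hQ : b 0 < (p : ℤ) + b 2 + b 7) (hQ34 : (p : ℤ) + b 3 + b 4 ≤ b 0)
    (hcas : casoratian b j ≠ 0) :
    dOf b / (p : ℤ) - pairFloors b p - min (if 2 ≤ dOf b / (p : ℤ) then (1 : ℤ) else 0) (5 - (cStar b p : ℤ))
      ≤ padicValRat p (casoratian b j) := by
  obtain ⟨hF1, hF2⟩ := fp_bounds hfp
  have hp0 : (0 : ℤ) < p := by exact_mod_cast hprime.pos
  rw [pairFloors_eq_10a hb hs hprime.pos hQ hQ34 hfp]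
  have hC9 : (cStar b p : ℤ) ≤ 9 := by exact_mod_cast cStar_le_nine_10a hs hQ
  obtain ⟨-, hd3⟩ := d_bounds10a hs hP hQ hQ34 hF1
  have hfd3 : dOf b / (p : ℤ) < 3 := by rw [Int.ediv_lt_iff_lt_mul hp0]; linarith
  by_cases h2 : 2 * (p : ℤ) ≤ dOf b
  · have hfd : 2 ≤ dOf b / (p : ℤ) := by rw [Int.le_ediv_iff_mul_le hp0]; linarith
    rw [if_pos hfd]
    have hmin' : -4 ≤ min (1 : ℤ) (5 - (cStar b p : ℤ)) := le_min (by norm_num) (by linarith)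
    linarith [cas_ge10a_neg4 hb hs hbj hj1 hj7 hprime hp5 hwin hP hQ hQ34 hF1 hF2 h2 hcas]
  · push Not at h2
    have hfd : dOf b / (p : ℤ) < 2 := by rw [Int.ediv_lt_iff_lt_mul hp0]; linarith
    have hmin : -4 ≤ min (if 2 ≤ dOf b / (p : ℤ) then (1 : ℤ) else 0) (5 - (cStar b p : ℤ)) :=
      le_min (by split_ifs <;> norm_num) (by linarith)
    linarith [cas_ge10a_neg5 hb hs hbj hj1 hj7 hprime hp5 hwin hP hQ hQ34 hF1 hF2 hcas]

/-- **THE NODE ON THIS `N_p = 10` PROFILE, EVERY SORTED `b`, EVERY DEPTH: `PathAccountingFirstPeriod` with its binders VERBATIM plus `p ≤ b₇` and the profile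
inequalities.** -/
theorem pathAccountingFirstPeriod_profile10a :
    ∀ (b : ℕ → ℤ) (p : ℕ), InPolytope b → Sorted7 b → InPolytope (shift b 7) →
      p.Prime → 5 ≤ p → (b 0 + 2 : ℤ) < (p : ℤ) ^ 2 → FirstPeriod b p →
      (p : ℤ) ≤ b 7 → b 0 < (p : ℤ) + b 2 + b 7 → (p : ℤ) + b 3 + b 4 ≤ b 0 → casoratian b 7 ≠ 0 →
        dOf b / (p : ℤ) - pairFloors b p - min (if 2 ≤ dOf b / (p : ℤ) then (1 : ℤ) else 0) (5 - (cStar b p : ℤ))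
          ≤ padicValRat p (casoratian b 7) :=
  fun b p hb hs hb7 hprime hp5 hwin hfp hP hQ hQ34 hcas =>
    pathAccounting_profile10a b 7 p hb hs hb7 (by norm_num) (by norm_num) hprime hp5 hwin hfp hP hQ hQ34 hcas

end P10A

/-! ## The `N_p = 10` profile with short blocks `all (i,k) with k ≤ 5, and (1,6)` -/

section P10B

variable {b : ℕ → ℤ} {j p : ℕ}

/-- **`N_p = 10`** on this profile: the pair digits of the eleven short blocks are `0`, the other ten are `1`. -/
theorem pairFloors_eq_10b (hb : InPolytope b) (hs : Sorted7 b) (hp : 0 < p) (hQ : b 0 < (p : ℤ) + b 4 + b 5) (hQ16 : b 0 < (p : ℤ) + b 1 + b 6) (hQ7 : (p : ℤ) + b 1 + b 7 ≤ b 0) (hQ26 : (p : ℤ) + b 2 + b 6 ≤ b 0) (hfp : FirstPeriod b p) : pairFloors b p = 10 := by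
  obtain ⟨h21, h32, h43, h54, h65, h76⟩ := sorted7_chain hs
  obtain ⟨h0, hb1, hb2, hb3, hb4, hb5, hb6, hb7, hc1⟩ := box hb
  have hp0 : (0 : ℤ) < p := by exact_mod_cast hp
  have one : ∀ z : ℤ, (p : ℤ) ≤ z → z ≤ 2 * (p : ℤ) - 1 → z / (p : ℤ) = 1 := fun z h1 h2 => by
    rw [Int.ediv_eq_iff_of_pos hp0]; constructor <;> linarith
  have z12 : (b 0 - b 1 - b 2) / (p : ℤ) = 0 := Int.ediv_eq_zero_of_lt (by linarith) (by linarith)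
  have z13 : (b 0 - b 1 - b 3) / (p : ℤ) = 0 := Int.ediv_eq_zero_of_lt (by linarith) (by linarith)
  have z14 : (b 0 - b 1 - b 4) / (p : ℤ) = 0 := Int.ediv_eq_zero_of_lt (by linarith) (by linarith)
  have z15 : (b 0 - b 1 - b 5) / (p : ℤ) = 0 := Int.ediv_eq_zero_of_lt (by linarith) (by linarith)
  have z16 : (b 0 - b 1 - b 6) / (p : ℤ) = 0 := Int.ediv_eq_zero_of_lt (by linarith) (by linarith)
  have z23 : (b 0 - b 2 - b 3) / (p : ℤ) = 0 := Int.ediv_eq_zero_of_lt (by linarith) (by linarith)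
  have z24 : (b 0 - b 2 - b 4) / (p : ℤ) = 0 := Int.ediv_eq_zero_of_lt (by linarith) (by linarith)
  have z25 : (b 0 - b 2 - b 5) / (p : ℤ) = 0 := Int.ediv_eq_zero_of_lt (by linarith) (by linarith)
  have z34 : (b 0 - b 3 - b 4) / (p : ℤ) = 0 := Int.ediv_eq_zero_of_lt (by linarith) (by linarith)
  have z35 : (b 0 - b 3 - b 5) / (p : ℤ) = 0 := Int.ediv_eq_zero_of_lt (by linarith) (by linarith)
  have z45 : (b 0 - b 4 - b 5) / (p : ℤ) = 0 := Int.ediv_eq_zero_of_lt (by linarith) (by linarith)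
  have U := fun (i k : ℕ) (hi : i < 7) (hk : k < 7) (hik : i < k) => firstPeriod_pair hfp hi hk hik
  rw [pairFloors_expand, z12, z13, z14, z15, z16, z23, z24, z25, z34, z35, z45,
    one _ (by linarith) (U 0 6 (by norm_num) (by norm_num) (by norm_num)),
    one _ (by linarith) (U 1 5 (by norm_num) (by norm_num) (by norm_num)),
    one _ (by linarith) (U 1 6 (by norm_num) (by norm_num) (by norm_num)),
    one _ (by linarith) (U 2 5 (by norm_num) (by norm_num) (by norm_num)),
    one _ (by linarith) (U 2 6 (by norm_num) (by norm_num) (by norm_num)),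
    one _ (by linarith) (U 3 5 (by norm_num) (by norm_num) (by norm_num)),
    one _ (by linarith) (U 3 6 (by norm_num) (by norm_num) (by norm_num)),
    one _ (by linarith) (U 4 5 (by norm_num) (by norm_num) (by norm_num)),
    one _ (by linarith) (U 4 6 (by norm_num) (by norm_num) (by norm_num)),
    one _ (by linarith) (U 5 6 (by norm_num) (by norm_num) (by norm_num))]
  norm_num

/-- **THEOREM LB on this profile, general `b`, any depth**: `v_p(Cas_j(b)) ≥ -5 = VB + row` (`(A, B) = (-4, -1)`, `B ≤ 0` so no hypothesis on `d`;
gen 22's `FullProfile.casLB_ge_of_cover_le0`). -/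
theorem cas_ge10b_neg5 (hb : InPolytope b) (hs : Sorted7 b) (hbj : InPolytope (shift b j)) (hj1 : 1 ≤ j) (hj7 : j ≤ 7)
    (hprime : p.Prime) (hp5 : 5 ≤ p) (hwin : (b 0 + 2 : ℤ) < (p : ℤ) ^ 2) (hP : (p : ℤ) ≤ b 7) (hQ : b 0 < (p : ℤ) + b 4 + b 5) (hQ16 : b 0 < (p : ℤ) + b 1 + b 6) (hQ7 : (p : ℤ) + b 1 + b 7 ≤ b 0) (hQ26 : (p : ℤ) + b 2 + b 6 ≤ b 0)
    (hF1 : b 1 < 2 * (p : ℤ)) (hF2 : b 0 < 2 * (p : ℤ) + b 6 + b 7) (hcas : casoratian b j ≠ 0) : (-5 : ℤ) ≤ padicValRat p (casoratian b j) := by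
  haveI : Fact p.Prime := ⟨hprime⟩
  have hp2 : p % 2 = 1 := Nat.odd_iff.1 (hprime.odd_of_ne_two (by omega))
  have hv := casoratianClassBound_holds b j p hb hj1 hj7 hbj hprime hp5 hwin hcas
  rcases Int.emod_two_eq_zero_or_one (b 0) with hr | hr
  · rcases casLB_ge_of_cover_le0 (cover10b_ev hb hs hP hQ hQ16 hQ7 hQ26 hF1 hF2 hp5 hp2 hr) (A := -4) (B := -1) (by rw [oddFlag_false hr]; decide) (by norm_num) with h0 | h
    · rw [h0] at hv; linarith
    · linarith
  · rcases casLB_ge_of_cover_le0 (cover10b_od hb hs hP hQ hQ16 hQ7 hQ26 hF1 hF2 hp5 hp2 hr) (A := -4) (B := -1) (by rw [oddFlag_true hr]; decide) (by norm_num) with h0 | h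
    · rw [h0] at hv; linarith
    · linarith

/-- On this profile `d(b) < 2p`. -/
theorem d_lt_two10b (hs : Sorted7 b) (hP : (p : ℤ) ≤ b 7) (_hQ : b 0 < (p : ℤ) + b 4 + b 5) (_hQ16 : b 0 < (p : ℤ) + b 1 + b 6) (_hQ7 : (p : ℤ) + b 1 + b 7 ≤ b 0) (_hQ26 : (p : ℤ) + b 2 + b 6 ≤ b 0) : dOf b < 2 * (p : ℤ) := by
  obtain ⟨h21, h32, h43, h54, h65, h76⟩ := sorted7_chain hs
  rw [DecompositionWholeCone.dOf_expand]; linarith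

/-- **`PathAccountingFirstPeriod`'s conclusion on this `N_p = 10` profile (short blocks `all (i,k) with k ≤ 5, and (1,6)`), EVERY sorted `b`, every direction `j`** (`C⋆ ≤ 9`, `p < d < 2p`:
the node asks `1 − 10 + 4 = -5`). -/
theorem pathAccounting_profile10b (b : ℕ → ℤ) (j p : ℕ) (hb : InPolytope b) (hs : Sorted7 b) (hbj : InPolytope (shift b j))
    (hj1 : 1 ≤ j) (hj7 : j ≤ 7) (hprime : p.Prime) (hp5 : 5 ≤ p) (hwin : (b 0 + 2 : ℤ) < (p : ℤ) ^ 2) (hfp : FirstPeriod b p)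
    (hP : (p : ℤ) ≤ b 7) (hQ : b 0 < (p : ℤ) + b 4 + b 5) (hQ16 : b 0 < (p : ℤ) + b 1 + b 6) (hQ7 : (p : ℤ) + b 1 + b 7 ≤ b 0) (hQ26 : (p : ℤ) + b 2 + b 6 ≤ b 0)
    (hcas : casoratian b j ≠ 0) :
    dOf b / (p : ℤ) - pairFloors b p - min (if 2 ≤ dOf b / (p : ℤ) then (1 : ℤ) else 0) (5 - (cStar b p : ℤ))
      ≤ padicValRat p (casoratian b j) := by
  obtain ⟨hF1, hF2⟩ := fp_bounds hfp
  have hp0 : (0 : ℤ) < p := by exact_mod_cast hprime.pos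
  rw [pairFloors_eq_10b hb hs hprime.pos hQ hQ16 hQ7 hQ26 hfp]
  have hC9 : (cStar b p : ℤ) ≤ 9 := by exact_mod_cast cStar_le_nine_10b hs hQ hQ16
  have hmin : -4 ≤ min (if 2 ≤ dOf b / (p : ℤ) then (1 : ℤ) else 0) (5 - (cStar b p : ℤ)) :=
    le_min (by split_ifs <;> norm_num) (by linarith)
  have hfd : dOf b / (p : ℤ) < 2 := by rw [Int.ediv_lt_iff_lt_mul hp0]; linarith [d_lt_two10b hs hP hQ hQ16 hQ7 hQ26]
  linarith [cas_ge10b_neg5 hb hs hbj hj1 hj7 hprime hp5 hwin hP hQ hQ16 hQ7 hQ26 hF1 hF2 hcas]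

/-- **THE NODE ON THIS `N_p = 10` PROFILE, EVERY SORTED `b`: `PathAccountingFirstPeriod` with its binders VERBATIM plus `p ≤ b₇` and the profile
inequalities.** -/
theorem pathAccountingFirstPeriod_profile10b :
    ∀ (b : ℕ → ℤ) (p : ℕ), InPolytope b → Sorted7 b → InPolytope (shift b 7) →
      p.Prime → 5 ≤ p → (b 0 + 2 : ℤ) < (p : ℤ) ^ 2 → FirstPeriod b p →
      (p : ℤ) ≤ b 7 → b 0 < (p : ℤ) + b 4 + b 5 → b 0 < (p : ℤ) + b 1 + b 6 → (p : ℤ) + b 1 + b 7 ≤ b 0 → (p : ℤ) + b 2 + b 6 ≤ b 0 → casoratian b 7 ≠ 0 →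
        dOf b / (p : ℤ) - pairFloors b p - min (if 2 ≤ dOf b / (p : ℤ) then (1 : ℤ) else 0) (5 - (cStar b p : ℤ))
          ≤ padicValRat p (casoratian b 7) :=
  fun b p hb hs hb7 hprime hp5 hwin hfp hP hQ hQ16 hQ7 hQ26 hcas =>
    pathAccounting_profile10b b 7 p hb hs hb7 (by norm_num) (by norm_num) hprime hp5 hwin hfp hP hQ hQ16 hQ7 hQ26 hcas

end P10B

end Summit.KontsevichZagierPeriods.Zeta5Search.FullProfile
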